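import Mathlib.Topology.MetricSpace.Lipschitz
import Mathlib.Topology.UniformSpace.HeineCantor
import HarnessLib

/-!
# Lipschitz approximation of uniformly continuous functions (McShane–Pasch–Hausdorff envelope)

Topic `Literature/Analysis/Approximation`.

For a real function `f` on a pseudo-metric space and `K ≥ 0`, the **inf-convolution**
(Pasch–Hausdorff / McShane envelope) `f_K(x) = inf_y (f(y) + K·dist(x, y))` is `K`-Lipschitz and lies
below `f`; if `f` is bounded by `M` in absolute value then so is `f_K`, and if `f` is UNIFORMLY
CONTINUOUS then `f - η ≤ f_K ≤ f` as soon as `K·δ(η) ≥ 2M` (`δ(η)` a modulus of uniform continuity).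
Consequently every bounded uniformly continuous function — in particular every continuous function on a
compact metric space — is a uniform limit of Lipschitz functions WITH THE SAME SUP BOUND (no loss in
`‖·‖_∞`, which matters when the bound is part of the specification, e.g. test functions `|φ| ≤ 1`).

* `exists_lipschitzWith_approx_of_uniformContinuous` — bounded uniformly continuous `f`, `η > 0`:
  a `K`-Lipschitz `g` with `g ≤ f ≤ g + η` and `|g| ≤ M`;
* `exists_lipschitz_approx_of_continuous` — the compact-space corollary in elementary form
  (`D > 0`, `|g x - g y| ≤ D·dist x y`, `|f - g| ≤ η`, `|g| ≤ M`, `g` continuous).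

Mathlib has the McShane EXTENSION of a Lipschitz function (`LipschitzOnWith.extend_real`, same
envelope over a subset) but not this approximation statement (searched `Lipschitz`, `iInf … dist`,
`dense` in `Topology/MetricSpace`, `Topology/ContinuousMap`).  No new definitions: the envelope is a
local term of the proofs.

## References

* E. J. McShane, *Extension of range of functions*, Bull. Amer. Math. Soc. 40 (1934) 837–842 (the
  envelope `inf_y f(y) + K d(x,y)`); the approximation statement is standard real analysis (e.g.
  J. Heinonen, *Lectures on Analysis on Metric Spaces* (2001), Thm. 6.8).  Tagged [folklore].
-/

namespace Literature.Analysis.Approximation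

open scoped NNReal

variable {X : Type*} [PseudoMetricSpace X]

/-- **Lipschitz approximation from below of a bounded uniformly continuous function** (McShane /
Pasch–Hausdorff inf-convolution).  If `f : X → ℝ` is uniformly continuous with `|f| ≤ M` and `η > 0`,
there are `K ≥ 0` and a `K`-Lipschitz `g : X → ℝ` with `g ≤ f ≤ g + η` pointwise and `|g| ≤ M`.
Proof: `g(x) = inf_y (f(y) + K dist(x,y))` with `K δ ≥ 2M`, `δ` the `η`-modulus of `f`: competitors
`y` with `dist(x,y) ≥ δ` cost at least `f(y) + 2M ≥ f(x)`, the others have `f(y) > f(x) - η`.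
[folklore] -/
theorem exists_lipschitzWith_approx_of_uniformContinuous {f : X → ℝ} (hf : UniformContinuous f)
    {M : ℝ} (hM : ∀ x, |f x| ≤ M) {η : ℝ} (hη : 0 < η) :
    ∃ (K : ℝ≥0) (g : X → ℝ), LipschitzWith K g ∧ (∀ x, g x ≤ f x) ∧ (∀ x, f x ≤ g x + η) ∧
      ∀ x, |g x| ≤ M := by
  obtain ⟨δ, hδ, hδf⟩ := Metric.uniformContinuous_iff.1 hf η hη
  -- the Lipschitz constant: `K δ ≥ 2M` (as soon as `X` is nonempty, `M ≥ 0` and `K = 2M/δ + 1`)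
  set K : ℝ≥0 := Real.toNNReal (2 * M / δ + 1) with hK
  set g : X → ℝ := fun x => ⨅ y, (f y + K * dist x y) with hg
  -- lower bound `-M` of every competitor, hence of the envelope
  have hlow : ∀ x y, -M ≤ f y + K * dist x y := fun x y => by
    have h1 : -M ≤ f y := (abs_le.1 (hM y)).1
    have h2 : (0 : ℝ) ≤ K * dist x y := mul_nonneg K.2 dist_nonneg
    linarith
  have hbdd : ∀ x, BddBelow (Set.range fun y => f y + K * dist x y) := fun x =>
    ⟨-M, by rintro _ ⟨y, rfl⟩; exact hlow x y⟩
  have hgle : ∀ x, g x ≤ f x := fun x => by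
    have h := ciInf_le (hbdd x) x
    simpa [hg] using h
  refine ⟨K, g, ?_, hgle, ?_, ?_⟩
  · -- `K`-Lipschitz: `g x ≤ f y + K d(x,y) ≤ (f y + K d(x',y)) + K d(x,x')` for every competitor `y`
    refine LipschitzWith.of_le_add_mul K fun x x' => ?_
    haveI : Nonempty X := ⟨x⟩
    have h : g x - K * dist x x' ≤ g x' := by
      refine le_ciInf fun y => ?_
      have h1 : g x ≤ f y + K * dist x y := ciInf_le (hbdd x) y
      have h2 : dist x y ≤ dist x x' + dist x' y := dist_triangle x x' y
      have h3 : (K : ℝ) * dist x y ≤ K * (dist x x' + dist x' y) :=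
        mul_le_mul_of_nonneg_left h2 K.2
      linarith
    linarith
  · -- `f ≤ g + η`
    intro x
    haveI : Nonempty X := ⟨x⟩
    have hM0 : 0 ≤ M := (abs_nonneg _).trans (hM x)
    have hKval : (K : ℝ) = 2 * M / δ + 1 := by
      rw [hK, Real.coe_toNNReal _ (by positivity)]
    have h : f x - η ≤ g x := by
      refine le_ciInf fun y => ?_
      by_cases hxy : dist x y < δ
      · have h1 : dist (f x) (f y) < η := hδf hxy
        rw [Real.dist_eq] at h1
        have h2 : f x - f y < η := (le_abs_self _).trans_lt h1
        have h3 : (0 : ℝ) ≤ K * dist x y := mul_nonneg K.2 dist_nonneg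
        linarith
      · push Not at hxy
        have h1 : (2 * M / δ + 1) * δ ≤ K * dist x y := by
          rw [hKval]
          exact mul_le_mul_of_nonneg_left hxy (by positivity)
        have h2 : (2 * M / δ + 1) * δ = 2 * M + δ := by field_simp
        have h3 : f x ≤ M := (abs_le.1 (hM x)).2
        have h4 : -M ≤ f y := (abs_le.1 (hM y)).1
        linarith
    linarith
  · -- `|g| ≤ M`
    intro x
    haveI : Nonempty X := ⟨x⟩
    rw [abs_le]
    exact ⟨le_ciInf fun y => hlow x y, (hgle x).trans (abs_le.1 (hM x)).2⟩

/-- **Lipschitz approximation of continuous functions on a compact metric space**, elementary form: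
for `f` continuous on a compact pseudo-metric space with `|f| ≤ M` and `η > 0` there are a continuous
`g` and `D > 0` with `|g| ≤ M`, `|g x - g y| ≤ D·dist x y` and `|f x - g x| ≤ η` for all `x, y`
(continuous on compact is uniformly continuous, `CompactSpace.uniformContinuous_of_continuous`, then
`exists_lipschitzWith_approx_of_uniformContinuous`; `D = K + 1`). [folklore] -/
theorem exists_lipschitz_approx_of_continuous [CompactSpace X] {f : X → ℝ} (hf : Continuous f)
    {M : ℝ} (hM : ∀ x, |f x| ≤ M) {η : ℝ} (hη : 0 < η) :
    ∃ (g : X → ℝ) (D : ℝ), Continuous g ∧ (∀ x, |g x| ≤ M) ∧ 0 < D ∧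
      (∀ x y, |g x - g y| ≤ D * dist x y) ∧ ∀ x, |f x - g x| ≤ η := by
  obtain ⟨K, g, hKg, hgf, hfg, hgM⟩ := exists_lipschitzWith_approx_of_uniformContinuous
    (CompactSpace.uniformContinuous_of_continuous hf) hM hη
  refine ⟨g, K + 1, hKg.continuous, hgM, by positivity, fun x y => ?_, fun x => ?_⟩
  · have h := hKg.dist_le_mul x y
    rw [Real.dist_eq] at h
    have h' : (K : ℝ) * dist x y ≤ (K + 1) * dist x y :=
      mul_le_mul_of_nonneg_right (by linarith) dist_nonneg
    exact h.trans h'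
  · rw [abs_le]
    constructor <;> linarith [hgf x, hfg x, hη]

end Literature.Analysis.Approximation
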